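import Literature.AlgebraicGeometry.Motives.AbelianVarietyWeilPairingPullback
import Literature.AlgebraicGeometry.Motives.AbelianVarietyWeilPairingBaseChange
import Literature.AlgebraicGeometry.Motives.AbelianVarietyConjugate
import HarnessLib

/-!
# The Weil pairing of a base-changed divisor at images under a base-changed homomorphism:
# `ē^{Θ_L}(f_L x, f_L y) = ē^{(f^*Θ)_L}(x, y)` (Mumford §20 (3); Lang VII §2 Prop. 2 (iii)) — the «upstairs» step
# `ē^{(π_γ^*X)_ℂ}(κ_ℂ x, κ_ℂ y) = ē^{((κ ≫ π_γ)^*X)_ℂ}(x, y)` of Shimura 1998, proof of Thm. 18.6 (p. 168 L3)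

Layer `Literature/AlgebraicGeometry/Motives`, namespace `Literature.AlgebraicGeometry.Motives.AbelianVariety`.
KERNEL ONLY: theorems; no definition, no instance, no named fact, no `sorry` (net Literature debt 0).
Cell `hodgecm-mathlib` (D-0151), row II-1 `shimura1998_thm18_6` v2e, stub S5 `StubPolarisationTransport` (REPAIRED C′₁,
B-plan1 2026-08-28T03:52:30Z; architect B-p12, plan (B) 03:53:20Z; S5 lead B-p20): the UPSTAIRS step (director g1
04:01:19Z default (i)) moving the left-hand side of S5, `ē^{(X^γ)_ℂ}(ξ′.r u, ξ′.r w)` with `ξ′.r = κ_ℂ ∘ ξ.r`, to the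
`A₀ ⊗ ℂ` side: `= ē^{((κ ≫ π_γ)^*X)_ℂ}(ξ.r u, ξ.r w)`, where the divisor `κ^*π_γ^*X = κ⁻¹(X^σ)` is the one Shimura
reduces («`κ⁻¹(X^σ)~ = π⁻¹(X̃^f) = pX̃`», p. 168 L3).

THE PRINT.  D. Mumford, *Abelian Varieties* (1970), §20 p. 186, property (3) of `e_n`: `e_n(f(x), ŷ) = e_n(x, f̂(ŷ))`
(with `φ_{f^*L} = f̂ ∘ φ_L ∘ f`: the pairing of `f^*L` at `(x, y)` is the pairing of `L` at `(fx, fy)`); S. Lang,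
*Abelian Varieties*, VII §2 Prop. 2 (iii) and Prop. 3 (compatibility of `e_N` with homomorphisms and with extension
of the field of definition).  In the tree: B-p20's `weilPairingLevel_pullback_eq` (`Motives/AbelianVarietyWeilPairingPullback`,
p598346) and the base-change bookkeeping `toSchemeHom_baseChange_comp_fst` (`f_L ≫ pr_B = pr_A ≫ f`).

* §1 `pullback_baseChange_sameDivisor` — `(f_L)^*(pr_B^* Θ)` and `pr_A^*(f^*Θ)` are the same divisor on `A ⊗ L`;
* §2 **`weilPairingLevel_baseChange_map`** — for `f : A → B` over `k` with `f`, `f_L` dominant, a Cartier divisor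
  `Θ` on `B` and `x, y ∈ (A ⊗ L)[N](L)`: `ē_N^{pr_B^*Θ}(f_L x, f_L y) = ē_N^{pr_A^*(f^*Θ)}(x, y)`;
* §3 **`weilPairingLevel_conjugate_baseChange_map`** — the same with `B := A^γ` (`AbelianVariety.conjugate γ`),
  `Θ := π_γ^* X`, in EXACTLY the binder shapes of S5-C′₁ (`πγ`, `πA`, `πB` as variables with defining equations,
  `κ : A₀ ⟶ A₀.conjugate γ`): `ē_N^{(π_γ^*X)_L}(κ_L x, κ_L y) = ē_N^{((κ^*π_γ^*X))_L}(x, y)`.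

## References
* [MumfordAV1970] D. Mumford, *Abelian Varieties* (1970), §20 property (3) of `e_n` (p. 186).
* [Lang1983AbelianVarieties] S. Lang, *Abelian Varieties*, Ch. VII §2, Props. 2 (iii), 3.
* [Shimura1998] G. Shimura, *Abelian Varieties with Complex Multiplication and Modular Functions* (1998), §18.6 proof of
  Thm. 18.6, p. 168 L3 (`κ⁻¹(X^σ)`).
-/

universe u

open CategoryTheory CategoryTheory.Limits AlgebraicGeometry

noncomputable section

namespace Literature.AlgebraicGeometry.Motives

namespace AbelianVariety

/-! ## §1–§2 General `f : A → B` over `k`, read after base change to `L` -/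

section General

variable {k : Type u} [Field k] (L : Type u) [Field L] [Algebra k L] {A B : AbelianVariety k} (f : A ⟶ B)
  [IsDominant (Hom.toSchemeHom f)] [IsDominant (Hom.toSchemeHom (Hom.baseChange L f))]
  (prA : (A.baseChange L).X.left ⟶ A.X.left) (hprA : prA = pullback.fst A.X.hom (bcSpec k L)) [IsDominant prA]
  (prB : (B.baseChange L).X.left ⟶ B.X.left) (hprB : prB = pullback.fst B.X.hom (bcSpec k L)) [IsDominant prB]

include hprA hprB in
/-- **`(f_L)^*(pr_B^*Θ) ∼ pr_A^*(f^*Θ)` on `A ⊗ L`**: both are the pullback of `Θ` along `A ⊗ L → B`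
(`f_L ≫ pr_B = pr_A ≫ f`, `toSchemeHom_baseChange_comp_fst`). [cite: MumfordAV1970, §20 (p. 186)] [cite: Lang1983AbelianVarieties, Ch. VII §2 Prop. 3] -/
theorem pullback_baseChange_sameDivisor (Θ : CartierDivisor B.X.left) :
    ((Θ.pullback (Hom.toSchemeHom f)).pullback prA).SameDivisor
      ((Θ.pullback prB).pullback (Hom.toSchemeHom (Hom.baseChange L f))) := by
  have hcomp : Hom.toSchemeHom (Hom.baseChange L f) ≫ prB = prA ≫ Hom.toSchemeHom f := by
    rw [hprA, hprB]
    exact toSchemeHom_baseChange_comp_fst L f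
  haveI : IsDominant (prA ≫ Hom.toSchemeHom f) := inferInstance
  haveI : IsDominant (Hom.toSchemeHom (Hom.baseChange L f) ≫ prB) := inferInstance
  exact ((Θ.pullback_pullback_sameDivisor (Hom.toSchemeHom f) prA).trans
    (Θ.pullback_congr_sameDivisor hcomp.symm)).trans (Θ.pullback_pullback_sameDivisor prB _).symm

variable {N : ℕ} [IsDominant (Hom.toSchemeHom ((N : ℤ) • 𝟙 (A.baseChange L)))]
  [IsDominant (Hom.toSchemeHom ((N : ℤ) • 𝟙 (B.baseChange L)))]

include hprA hprB in
/-- **`ē_N^{pr_B^*Θ}(f_L x, f_L y) = ē_N^{pr_A^*(f^*Θ)}(x, y)`** for `x, y ∈ (A ⊗ L)[N](L)` (Mumford §20 (3) for the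
homomorphism `f_L = f ⊗ L` and the divisor `pr_B^*Θ`, whose pullback along `f_L` is `pr_A^*(f^*Θ)`).
[cite: MumfordAV1970, §20 property (3) of e_n (p. 186)] [cite: Lang1983AbelianVarieties, Ch. VII §2 Prop. 2 (iii)] -/
theorem weilPairingLevel_baseChange_map (Θ : CartierDivisor B.X.left) (x y : (A.baseChange L).torsionPoints L N) :
    (B.baseChange L).weilPairingLevel (Θ.pullback prB)
        ⟨AlgPoints.map (Hom.baseChange L f).hom.hom.hom x.1, map_mem_torsionPoints (Hom.baseChange L f) x.2⟩
        ⟨AlgPoints.map (Hom.baseChange L f).hom.hom.hom y.1, map_mem_torsionPoints (Hom.baseChange L f) y.2⟩ =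
      (A.baseChange L).weilPairingLevel ((Θ.pullback (Hom.toSchemeHom f)).pullback prA) x y :=
  (weilPairingLevel_eq_of_sameDivisor_pullback (Hom.baseChange L f) (Θ.pullback prB)
    (pullback_baseChange_sameDivisor L f prA hprA prB hprB Θ) x y).symm

end General

/-! ## §3 The S5-C′₁ shape: `κ : A₀ → A₀^γ`, `Θ = π_γ^* X` -/

section Conjugate

variable {k : Type u} [Field k] (L : Type u) [Field L] [Algebra k L] (γ : k ≃+* k) (A₀ : AbelianVariety k)
  (κ : A₀ ⟶ A₀.conjugate γ) [IsDominant (Hom.toSchemeHom κ)] [IsDominant (Hom.toSchemeHom (Hom.baseChange L κ))]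
  (X : CartierDivisor A₀.X.left)
  (πγ : (A₀.conjugate γ).X.left ⟶ A₀.X.left) (hπγ : πγ = baseChangeHomFst γ.toRingHom A₀.X) [IsDominant πγ]
  (πA : (A₀.baseChange L).X.left ⟶ A₀.X.left) (hπA : πA = pullback.fst A₀.X.hom (bcSpec k L)) [IsDominant πA]
  (πB : ((A₀.conjugate γ).baseChange L).X.left ⟶ (A₀.conjugate γ).X.left)
  (hπB : πB = pullback.fst (A₀.conjugate γ).X.hom (bcSpec k L)) [IsDominant πB]
  {N : ℕ} [IsDominant (Hom.toSchemeHom ((N : ℤ) • 𝟙 (A₀.baseChange L)))]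
  [IsDominant (Hom.toSchemeHom ((N : ℤ) • 𝟙 ((A₀.conjugate γ).baseChange L)))]

include hπA hπB in
/-- **The upstairs step of S5**: `ē_N^{(π_γ^*X)_L}(κ_L x, κ_L y) = ē_N^{(κ^*π_γ^*X)_L}(x, y)` for `x, y ∈ (A₀ ⊗ L)[N](L)` —
the left-hand side of `StubPolarisationTransport` (at `ξ′.r = κ_ℂ ∘ ξ.r`) transported to `A₀ ⊗ L`, with the divisor
`κ⁻¹(X^σ) = κ^*π_γ^*X` that Shimura reduces next («`κ⁻¹(X^σ)~ = π⁻¹(X̃^f) = pX̃`»).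
[cite: Shimura1998, §18.6 proof of Thm. 18.6, p. 168 L3] [cite: MumfordAV1970, §20 property (3) of e_n (p. 186)] -/
theorem weilPairingLevel_conjugate_baseChange_map (x y : (A₀.baseChange L).torsionPoints L N) :
    ((A₀.conjugate γ).baseChange L).weilPairingLevel ((X.pullback πγ).pullback πB)
        ⟨AlgPoints.map (Hom.baseChange L κ).hom.hom.hom x.1, map_mem_torsionPoints (Hom.baseChange L κ) x.2⟩
        ⟨AlgPoints.map (Hom.baseChange L κ).hom.hom.hom y.1, map_mem_torsionPoints (Hom.baseChange L κ) y.2⟩ =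
      (A₀.baseChange L).weilPairingLevel (((X.pullback πγ).pullback (Hom.toSchemeHom κ)).pullback πA) x y :=
  weilPairingLevel_baseChange_map L κ πA hπA πB hπB (X.pullback πγ) x y

include hπA hπB in
/-- **… in equation form for prescribed images** (`x′ = κ_L x`, `y′ = κ_L y` as points, e.g. `x′ = ξ′.r u`,
`x = ξ.r u` under «`ξ′.r = κ_ℂ ∘ ξ.r`»): `ē_N^{(π_γ^*X)_L}(x′, y′) = ē_N^{(κ^*π_γ^*X)_L}(x, y)`.
[cite: Shimura1998, §18.6 proof of Thm. 18.6, p. 168 L3] [cite: MumfordAV1970, §20 property (3) of e_n (p. 186)] -/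
theorem weilPairingLevel_conjugate_baseChange_eq_of_map_eq (x y : (A₀.baseChange L).torsionPoints L N)
    (x' y' : ((A₀.conjugate γ).baseChange L).torsionPoints L N)
    (hx : (x' : ((A₀.conjugate γ).baseChange L).Points L) = AlgPoints.map (Hom.baseChange L κ).hom.hom.hom x.1)
    (hy : (y' : ((A₀.conjugate γ).baseChange L).Points L) = AlgPoints.map (Hom.baseChange L κ).hom.hom.hom y.1) :
    ((A₀.conjugate γ).baseChange L).weilPairingLevel ((X.pullback πγ).pullback πB) x' y' =
      (A₀.baseChange L).weilPairingLevel (((X.pullback πγ).pullback (Hom.toSchemeHom κ)).pullback πA) x y := by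
  obtain ⟨x', hx'⟩ := x'
  obtain ⟨y', hy'⟩ := y'
  change x' = _ at hx
  change y' = _ at hy
  subst hx hy
  exact A₀.weilPairingLevel_conjugate_baseChange_map L γ κ X πγ πA hπA πB hπB x y

end Conjugate

end AbelianVariety

end Literature.AlgebraicGeometry.Motives

end
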